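import Literature.Analysis.UnboundedOperators.LinearizedBoltzmannGainWeights
import Mathlib.MeasureTheory.Integral.MeanInequalities
import HarnessLib

/-!
# The linearised hard-sphere operator: the loss and gain forms are bounded on `L²(M dv)`

Sibling proof file of `LinearizedBoltzmann.lean` (towards the discharge of
`exists_isSelfAdjoint_hasCore`, CIP 1994 §7.2 Thm 7.2.1). With `B = ((v - v_*)·ω)₊`,
`M` the global Maxwellian and `dλ = dv dv_* dω` on `E × E × S^{d-1}`, the linearised hard-sphere
operator splits on functions of temperate growth as `L g = K₂' g + K₂'' g - K₁ g - ν g`, where the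
three integral operators have the bilinear forms (against `h` in `L²(M dv)`), all instances of
`kernelForm φ h g = ∫ B M M_* h(v) g(φ(v, v_*, ω)) dλ` (`collisionDensity = B M M_*`):

* `kernelForm lossVel h g    = ∫ B M M_* h(v) g(v_*) dλ`  (`K₁`, loss; `lossVel q = v_*`),
* `kernelForm gainVelFst h g = ∫ B M M_* h(v) g(v') dλ`   (`K₂'`, gain; `gainVelFst q = v'`),
* `kernelForm gainVelSnd h g = ∫ B M M_* h(v) g(v_*') dλ` (`K₂''`, gain; `gainVelSnd q = v_*'`).

**Main result** (Grad's `K ∈ B(L²)`, CIP 1994 §7.2 Thms 7.2.2–7.2.4, here for all `d ≥ 2` and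
without kernels): for `h, g ∈ L²(M dv)` each form is absolutely convergent with
`∫ |B M M_* h(v) g(φ)| dλ ≤ C ‖h‖_{L²(M)} ‖g‖_{L²(M)}`
(`lintegral_enorm_kernelForm_lossVel_le`, `lintegral_enorm_kernelForm_gainVelFst_le`,
`lintegral_enorm_kernelForm_gainVelSnd_le`, the last one in dimension `d ≥ 2`; the constants are
`lossRowConst`, `gainFstRowConst`, `gainSndRowConst hE`), whence integrability of the integrand
and `|kernelForm φ h g| ≤ C ‖h‖ ‖g‖` (`integrable_and_abs_kernelForm_le`); the forms are symmetric
(`kernelForm_lossVel_comm`, `kernelForm_gainVelFst_comm`, `kernelForm_gainVelSnd_comm`),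
bilinear (`kernelForm_add_left/right`, `kernelForm_smul_left/right`) and only depend on the
`M dv`-a.e. classes of `h, g` (`kernelForm_congr_ae`).

Proof: the weighted Cauchy–Schwarz inequality `lintegral_mul_mul_le_of_involution` — for a
measure-preserving involution `T` of `λ`, a `T`-invariant density `ρ = B M M_*` and a weight with
`w ∘ T = w⁻¹`, `∫ ρ F G ≤ (∫ ρ w F²)^{1/2} (∫ ρ w (G ∘ T)²)^{1/2}` — with `T = T₂, T₂T₁, T₁`
(`T₁ = (v_*', v', ω)`, `T₂ = (v_*, v, -ω)`, `Literature.Analysis.FluidPDE.CollisionWeakForm`)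
and the detailed-balance weights of `LinearizedBoltzmannGainWeights`, whose row bounds turn both
factors into `C ∫ M f²` (`lintegral_collisionDensity_weight_mul_le`, Tonelli).

## References

* C. Cercignani, R. Illner, M. Pulvirenti, *The Mathematical Theory of Dilute Gases*, Springer
  (1994), §7.2 Thm 7.2.1 p. 197, Thms 7.2.2–7.2.4 pp. 197–199.
* H. Grad, *Asymptotic theory of the Boltzmann equation II*, Rarefied Gas Dynamics I (1963).
-/

open MeasureTheory Metric Real Set Filter Topology ProbabilityTheory Module
open scoped InnerProductSpace ENNReal

namespace Literature.Analysis.UnboundedOperators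

noncomputable section

open Literature.MathematicalPhysics.KineticTheory (collide sphereMeasure hardSphereKernel
  collide_collide)
open Literature.Analysis.FluidPDE

/-! ### A weighted Cauchy–Schwarz inequality with an involution -/

section WeightedCS

variable {X : Type*} [MeasurableSpace X] {μ : Measure X}

/-- **Weighted Cauchy–Schwarz with detailed balance.** Let `T` preserve `μ`, let `ρ` be a
`T`-invariant density and `w` a weight with `w(Tx) w(x) = 1`. Then
`∫ ρ F G ≤ (∫ ρ w F²)^{1/2} (∫ ρ w (G ∘ T)²)^{1/2}`: write `ρ F G = (ρ w F²)^{1/2} (ρ w⁻¹ G²)^{1/2}`,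
apply Cauchy–Schwarz and change variables by `T` in the second factor. (This is the mechanism
behind Grad's/CIP's Schur bounds for the symmetrised kernel, CIP 1994 §7.2 (2.17).) [folklore] -/
theorem lintegral_mul_mul_le_of_involution {T : X → X} (hT : MeasurePreserving T μ μ)
    {ρ w F G : X → ℝ≥0∞} (hρ : Measurable ρ) (hw : Measurable w) (hF : AEMeasurable F μ)
    (hG : AEMeasurable G μ) (hρT : ∀ x, ρ (T x) = ρ x) (hwT : ∀ x, w (T x) * w x = 1) :
    ∫⁻ x, ρ x * F x * G x ∂μ ≤
      (∫⁻ x, ρ x * w x * F x ^ (2 : ℝ) ∂μ) ^ (1 / 2 : ℝ) *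
        (∫⁻ x, ρ x * w x * G (T x) ^ (2 : ℝ) ∂μ) ^ (1 / 2 : ℝ) := by
  have hw0 : ∀ x, w x ≠ 0 := fun x h => by
    have := hwT x; rw [h, mul_zero] at this; exact zero_ne_one this
  have hwt : ∀ x, w x ≠ ∞ := fun x h => by
    have := hwT x; rw [h, ENNReal.mul_top (hw0 (T x))] at this; exact ENNReal.top_ne_one this
  have hwinv : ∀ x, (w (T x))⁻¹ = w x := fun x => by
    rw [ENNReal.eq_inv_of_mul_eq_one_left (hwT x), inv_inv]
  set A : X → ℝ≥0∞ := fun x => ρ x * w x * F x ^ (2 : ℝ) with hA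
  set B : X → ℝ≥0∞ := fun x => ρ x * (w x)⁻¹ * G x ^ (2 : ℝ) with hB
  have hAm : AEMeasurable A μ := ((hρ.mul hw).aemeasurable).mul (hF.pow_const _)
  have hBm : AEMeasurable B μ := ((hρ.mul hw.inv).aemeasurable).mul (hG.pow_const _)
  -- `ρ F G = A^{1/2} B^{1/2}`
  have hsplit : ∀ x, ρ x * F x * G x = A x ^ (1 / 2 : ℝ) * B x ^ (1 / 2 : ℝ) := by
    intro x
    have h2 : (0 : ℝ) ≤ 1 / 2 := by norm_num
    rw [← ENNReal.mul_rpow_of_nonneg _ _ h2]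
    have hAB : A x * B x = (ρ x * F x * G x) ^ (2 : ℝ) := by
      simp only [hA, hB]
      rw [ENNReal.rpow_two, ENNReal.rpow_two, ENNReal.rpow_two]
      have : w x * (w x)⁻¹ = 1 := ENNReal.mul_inv_cancel (hw0 x) (hwt x)
      calc ρ x * w x * F x ^ 2 * (ρ x * (w x)⁻¹ * G x ^ 2)
          = (w x * (w x)⁻¹) * (ρ x * F x * G x) ^ 2 := by ring
        _ = _ := by rw [this, one_mul]
    rw [hAB, ← ENNReal.rpow_mul, show (2 : ℝ) * (1 / 2) = 1 by norm_num, ENNReal.rpow_one]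
  -- Cauchy–Schwarz
  have hCS := ENNReal.lintegral_mul_le_Lp_mul_Lq μ Real.HolderConjugate.two_two
    (hAm.pow_const (1 / 2 : ℝ)) (hBm.pow_const (1 / 2 : ℝ))
  have hpow : ∀ y : ℝ≥0∞, (y ^ (1 / 2 : ℝ)) ^ (2 : ℝ) = y := fun y => by
    rw [← ENNReal.rpow_mul, show (1 / 2 : ℝ) * 2 = 1 by norm_num, ENNReal.rpow_one]
  simp only [Pi.mul_apply, hpow] at hCS
  -- change variables in `∫ B`
  have hBT : ∫⁻ x, B x ∂μ = ∫⁻ x, ρ x * w x * G (T x) ^ (2 : ℝ) ∂μ := by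
    have h1 : ∫⁻ x, B x ∂μ = ∫⁻ x, B x ∂(Measure.map T μ) := by rw [hT.map_eq]
    rw [h1, lintegral_map' (by rw [hT.map_eq]; exact hBm) hT.measurable.aemeasurable]
    refine lintegral_congr fun x => ?_
    simp only [hB, hρT, hwinv]
  calc ∫⁻ x, ρ x * F x * G x ∂μ = ∫⁻ x, A x ^ (1 / 2 : ℝ) * B x ^ (1 / 2 : ℝ) ∂μ :=
        lintegral_congr hsplit
    _ ≤ (∫⁻ x, A x ∂μ) ^ (1 / 2 : ℝ) * (∫⁻ x, B x ∂μ) ^ (1 / 2 : ℝ) := hCS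
    _ = _ := by rw [hBT]

end WeightedCS

/-! ### The collision density and the row-sum lemma -/

section Density

variable {E : Type*} [NormedAddCommGroup E] [InnerProductSpace ℝ E] [FiniteDimensional ℝ E]
  [MeasurableSpace E] [BorelSpace E]

/-- The collision density `B M M_* = ((v - v_*)·ω)₊ M(v) M(v_*)` on `E × E × S^{d-1}`, the common
weight of the three kernel forms of the linearised hard-sphere operator (CIP 1994 §7.1 (7.1.6),
weighted picture `L²(M dv)`). [cite: CIP1994, §7.1 (7.1.6)] -/
def collisionDensity (q : (E × E) × sphere (0 : E) 1) : ℝ :=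
  hardSphereKernel q.1 q.2 * (globalMaxwellian q.1.1 * globalMaxwellian q.1.2)

omit [FiniteDimensional ℝ E] [MeasurableSpace E] [BorelSpace E] in
/-- `0 ≤ B M M_*`. [folklore] -/
theorem collisionDensity_nonneg (q : (E × E) × sphere (0 : E) 1) : 0 ≤ collisionDensity q :=
  mul_nonneg (le_max_right _ _) (mul_nonneg (globalMaxwellian_pos _).le (globalMaxwellian_pos _).le)

omit [FiniteDimensional ℝ E] [MeasurableSpace E] [BorelSpace E] in
/-- `B M M_*` is continuous. [folklore] -/
@[fun_prop]
theorem continuous_collisionDensity :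
    Continuous (collisionDensity : (E × E) × sphere (0 : E) 1 → ℝ) := by
  unfold collisionDensity hardSphereKernel
  fun_prop

/-- `B M M_*` is measurable. [folklore] -/
@[fun_prop]
theorem measurable_collisionDensity :
    Measurable (collisionDensity : (E × E) × sphere (0 : E) 1 → ℝ) :=
  continuous_collisionDensity.measurable

omit [FiniteDimensional ℝ E] [MeasurableSpace E] [BorelSpace E] in
/-- `B M M_*` is invariant under `T₁ : (v, v_*, ω) ↦ (v_*', v', ω)` (micro-reversibility of the
hard-sphere kernel and `M'M_*' = M M_*`; CIP 1994 §7.1). [cite: CIP1994, §7.1 (7.1.6)] -/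
theorem collisionDensity_collideSwap (q : (E × E) × sphere (0 : E) 1) :
    collisionDensity ((collide q.2 q.1).swap, q.2) = collisionDensity q := by
  simp only [collisionDensity, Prod.fst_swap, Prod.snd_swap,
    kernel_collideSwap (fun p ω => hardSphereKernel_collide_neg ω p)
      (fun p ω => hardSphereKernel_swap_neg ω p),
    globalMaxwellian_collide_snd_mul_fst]

omit [FiniteDimensional ℝ E] [MeasurableSpace E] [BorelSpace E] in
/-- `B M M_*` is invariant under `T₂ : (v, v_*, ω) ↦ (v_*, v, -ω)`. [folklore] -/
theorem collisionDensity_swap_negDir (q : (E × E) × sphere (0 : E) 1) :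
    collisionDensity (q.1.swap, -q.2) = collisionDensity q := by
  simp only [collisionDensity, Prod.fst_swap, Prod.snd_swap, hardSphereKernel_swap_neg]
  ring

omit [FiniteDimensional ℝ E] [MeasurableSpace E] [BorelSpace E] in
/-- `B M M_*` is invariant under `T₂ T₁ : (v, v_*, ω) ↦ (v', v_*', -ω)`. [folklore] -/
theorem collisionDensity_collide_negDir (q : (E × E) × sphere (0 : E) 1) :
    collisionDensity (collide q.2 q.1, -q.2) = collisionDensity q := by
  have h := collisionDensity_swap_negDir (E := E) ((collide q.2 q.1).swap, q.2)
  rw [Prod.swap_swap, collisionDensity_collideSwap] at h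
  exact h

/-- The composite involution `T₂ T₁ : (v, v_*, ω) ↦ (v', v_*', -ω)` preserves `dv dv_* dω`.
[folklore] -/
theorem measurePreserving_collide_negDir :
    MeasurePreserving (fun q : (E × E) × sphere (0 : E) 1 => (collide q.2 q.1, -q.2))
      (((volume : Measure E).prod volume).prod sphereMeasure)
      (((volume : Measure E).prod volume).prod sphereMeasure) := by
  have h := (measurePreserving_swap_negDir (E := E)).comp (measurePreserving_collideSwap_prod (E := E))
  have hfun : ((fun q : (E × E) × sphere (0 : E) 1 => (q.1.swap, -q.2)) ∘
      fun q : (E × E) × sphere (0 : E) 1 => ((collide q.2 q.1).swap, q.2)) =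
      fun q => (collide q.2 q.1, -q.2) := by
    funext q; simp
  rwa [hfun] at h

/-- `dv` is absolutely continuous with respect to `M dv` (the Maxwellian is positive), so that
`M dv`-a.e. statements transfer to Lebesgue measure. [folklore] -/
theorem volume_absolutelyContinuous_stdGaussian :
    (volume : Measure E) ≪ stdGaussian E := by
  rw [stdGaussian_eq_withDensity_globalMaxwellian_holds]
  exact withDensity_absolutelyContinuous'
    continuous_globalMaxwellian.measurable.ennreal_ofReal.aemeasurable
    (Eventually.of_forall fun v => (ENNReal.ofReal_pos.2 (globalMaxwellian_pos v)).ne')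

/-- An `L²(M dv)` function is a.e.-strongly measurable for Lebesgue measure. [folklore] -/
theorem aestronglyMeasurable_volume_of_stdGaussian {f : E → ℝ}
    (hf : AEStronglyMeasurable f (stdGaussian E)) : AEStronglyMeasurable f (volume : Measure E) :=
  hf.mono_ac volume_absolutelyContinuous_stdGaussian

/-- **The bridge `stdGaussian E = M dv` for squares**: `∫ M |f|² dv = ‖f‖²_{L²(M dv)}` as
`ℝ≥0∞`-integrals. [folklore] -/
theorem lintegral_globalMaxwellian_mul_enorm_sq {f : E → ℝ}
    (hf : AEStronglyMeasurable f (stdGaussian E)) :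
    ∫⁻ v, ENNReal.ofReal (globalMaxwellian v) * ‖f v‖ₑ ^ (2 : ℝ) =
      eLpNorm f 2 (stdGaussian E) ^ (2 : ℝ) := by
  have hfv := aestronglyMeasurable_volume_of_stdGaussian hf
  rw [eLpNorm_eq_lintegral_rpow_enorm_toReal two_ne_zero ENNReal.ofNat_ne_top, ENNReal.toReal_ofNat,
    ← ENNReal.rpow_mul, show 1 / (2 : ℝ) * 2 = 1 by norm_num, ENNReal.rpow_one,
    stdGaussian_eq_withDensity_globalMaxwellian_holds,
    lintegral_withDensity_eq_lintegral_mul₀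
      continuous_globalMaxwellian.measurable.ennreal_ofReal.aemeasurable (hfv.enorm.pow_const _)]
  rfl

/-- The projection `(v, v_*, ω) ↦ v` is quasi-measure-preserving `dλ → dv`. [folklore] -/
theorem quasiMeasurePreserving_fst_fst :
    Measure.QuasiMeasurePreserving (fun q : (E × E) × sphere (0 : E) 1 => q.1.1)
      (((volume : Measure E).prod volume).prod sphereMeasure) volume :=
  Measure.quasiMeasurePreserving_fst.comp Measure.quasiMeasurePreserving_fst

/-- The projection `(v, v_*, ω) ↦ v_*` is quasi-measure-preserving `dλ → dv`. [folklore] -/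
theorem quasiMeasurePreserving_fst_snd :
    Measure.QuasiMeasurePreserving (fun q : (E × E) × sphere (0 : E) 1 => q.1.2)
      (((volume : Measure E).prod volume).prod sphereMeasure) volume :=
  Measure.quasiMeasurePreserving_snd.comp Measure.quasiMeasurePreserving_fst

/-- The post-collisional velocity `(v, v_*, ω) ↦ v'` is quasi-measure-preserving `dλ → dv`
(unit Jacobian of the collision map). [folklore] -/
theorem quasiMeasurePreserving_collide_fst :
    Measure.QuasiMeasurePreserving (fun q : (E × E) × sphere (0 : E) 1 => (collide q.2 q.1).1)
      (((volume : Measure E).prod volume).prod sphereMeasure) volume := by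
  have h := quasiMeasurePreserving_fst_snd (E := E).comp
    (measurePreserving_collideSwap_prod (E := E)).quasiMeasurePreserving
  exact h

/-- The post-collisional velocity `(v, v_*, ω) ↦ v_*'` is quasi-measure-preserving `dλ → dv`.
[folklore] -/
theorem quasiMeasurePreserving_collide_snd :
    Measure.QuasiMeasurePreserving (fun q : (E × E) × sphere (0 : E) 1 => (collide q.2 q.1).2)
      (((volume : Measure E).prod volume).prod sphereMeasure) volume := by
  have h := quasiMeasurePreserving_fst_fst (E := E).comp
    (measurePreserving_collideSwap_prod (E := E)).quasiMeasurePreserving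
  exact h

/-- **Row-sum lemma** (Tonelli): if the rows `∫∫ B(v, v_*, ω) M(v_*) r dω dv_*` of a measurable
weight `r` (entering through `(r)₊ = ENNReal.ofReal r`) are bounded by `C` uniformly in `v`, then
`∫ B M M_* r F(v) dλ ≤ C ∫ M F dv`.
[folklore] -/
theorem lintegral_collisionDensity_weight_mul_le {r : (E × E) × sphere (0 : E) 1 → ℝ}
    (hrm : Measurable r) {C : ℝ≥0∞}
    (hC : ∀ v : E, ∫⁻ w, ∫⁻ ω, ENNReal.ofReal (hardSphereKernel (v, w) ω * globalMaxwellian w *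
      r ((v, w), ω)) ∂sphereMeasure ≤ C)
    {F : E → ℝ≥0∞} (hF : AEMeasurable F (volume : Measure E)) :
    ∫⁻ q, ENNReal.ofReal (collisionDensity q) * ENNReal.ofReal (r q) * F q.1.1
        ∂(((volume : Measure E).prod volume).prod sphereMeasure) ≤
      C * ∫⁻ v, ENNReal.ofReal (globalMaxwellian v) * F v := by
  haveI := isFiniteMeasure_sphereMeasure (E := E)
  have hFq : AEMeasurable (fun q : (E × E) × sphere (0 : E) 1 => F q.1.1)
      (((volume : Measure E).prod volume).prod sphereMeasure) :=
    hF.comp_quasiMeasurePreserving quasiMeasurePreserving_fst_fst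
  have hint : AEMeasurable (fun q : (E × E) × sphere (0 : E) 1 =>
      ENNReal.ofReal (collisionDensity q) * ENNReal.ofReal (r q) * F q.1.1)
      (((volume : Measure E).prod volume).prod sphereMeasure) :=
    ((measurable_collisionDensity.ennreal_ofReal.mul hrm.ennreal_ofReal).aemeasurable).mul hFq
  -- pointwise factorisation `B M M_* r F(v) = (M(v) F(v)) · (B M_* r)`
  have hpt : ∀ (v w : E) (ω : sphere (0 : E) 1),
      ENNReal.ofReal (collisionDensity ((v, w), ω)) * ENNReal.ofReal (r ((v, w), ω)) * F v =
        ENNReal.ofReal (globalMaxwellian v) * F v *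
          ENNReal.ofReal (hardSphereKernel (v, w) ω * globalMaxwellian w * r ((v, w), ω)) := by
    intro v w ω
    have hB0 : 0 ≤ hardSphereKernel (v, w) ω := le_max_right _ _
    simp only [collisionDensity]
    rw [ENNReal.ofReal_mul hB0, ENNReal.ofReal_mul (globalMaxwellian_pos v).le,
      ENNReal.ofReal_mul (mul_nonneg hB0 (globalMaxwellian_pos w).le), ENNReal.ofReal_mul hB0]
    ring
  -- the `(v_*, ω)`-integrand is jointly measurable, for every `v`
  have hH : ∀ v : E, Measurable fun p : E × sphere (0 : E) 1 =>
      ENNReal.ofReal (hardSphereKernel (v, p.1) p.2 * globalMaxwellian p.1 * r ((v, p.1), p.2)) := by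
    intro v
    refine Measurable.ennreal_ofReal ?_
    have hc : Continuous fun p : E × sphere (0 : E) 1 =>
        hardSphereKernel (v, p.1) p.2 * globalMaxwellian p.1 := by
      unfold hardSphereKernel; fun_prop
    exact hc.measurable.mul (hrm.comp (by fun_prop))
  rw [lintegral_prod _ hint, lintegral_prod _ hint.lintegral_prod_right']
  calc ∫⁻ v, ∫⁻ w, ∫⁻ ω, ENNReal.ofReal (collisionDensity ((v, w), ω)) *
          ENNReal.ofReal (r ((v, w), ω)) * F ((v, w), ω).1.1 ∂sphereMeasure
      = ∫⁻ v, ENNReal.ofReal (globalMaxwellian v) * F v * ∫⁻ w, ∫⁻ ω,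
          ENNReal.ofReal (hardSphereKernel (v, w) ω * globalMaxwellian w * r ((v, w), ω))
            ∂sphereMeasure := by
        refine lintegral_congr fun v => ?_
        have h1 : ∀ w : E, ∫⁻ ω, ENNReal.ofReal (collisionDensity ((v, w), ω)) *
            ENNReal.ofReal (r ((v, w), ω)) * F ((v, w), ω).1.1 ∂sphereMeasure =
            ENNReal.ofReal (globalMaxwellian v) * F v * ∫⁻ ω,
              ENNReal.ofReal (hardSphereKernel (v, w) ω * globalMaxwellian w * r ((v, w), ω))
                ∂sphereMeasure := by
          intro w
          have hHw : Measurable fun ω : sphere (0 : E) 1 =>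
              ENNReal.ofReal (hardSphereKernel (v, w) ω * globalMaxwellian w * r ((v, w), ω)) :=
            (hH v).comp measurable_prodMk_left
          rw [← lintegral_const_mul _ hHw]
          exact lintegral_congr fun ω => hpt v w ω
        simp_rw [h1]
        rw [lintegral_const_mul _ (hH v).lintegral_prod_right']
    _ ≤ ∫⁻ v, ENNReal.ofReal (globalMaxwellian v) * F v * C :=
        lintegral_mono fun v => mul_le_mul' le_rfl (hC v)
    _ = C * ∫⁻ v, ENNReal.ofReal (globalMaxwellian v) * F v := by
        have hm : AEMeasurable (fun v => ENNReal.ofReal (globalMaxwellian v) * F v)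
            (volume : Measure E) :=
          continuous_globalMaxwellian.measurable.ennreal_ofReal.aemeasurable.mul hF
        rw [lintegral_mul_const'' _ hm, mul_comm]

/-! ### The abstract form bound -/

/-- **Abstract kernel-form bound.** Let `T` be a `dλ`-preserving map leaving `B M M_*` invariant,
`φ` a quasi-measure-preserving velocity with `φ ∘ T = pr_v`, and `r > 0` a measurable weight
with `r(Tq) r(q) = 1` whose rows `∫∫ B(v,·,·) M r` are bounded by `C`. Then for
`f, g ∈ L²(M dv)`, `∫ B M M_* |f(v)| |g(φ)| dλ ≤ C ‖f‖ ‖g‖` (weighted Cauchy–Schwarz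
`lintegral_mul_mul_le_of_involution`, then the row-sum lemma on both factors). [folklore] -/
theorem lintegral_collisionDensity_mul_mul_le
    {T : (E × E) × sphere (0 : E) 1 → (E × E) × sphere (0 : E) 1}
    (hT : MeasurePreserving T (((volume : Measure E).prod volume).prod sphereMeasure)
      (((volume : Measure E).prod volume).prod sphereMeasure))
    (hρT : ∀ q, collisionDensity (T q) = collisionDensity q)
    {φ : (E × E) × sphere (0 : E) 1 → E}
    (hφ : Measure.QuasiMeasurePreserving φ (((volume : Measure E).prod volume).prod sphereMeasure)
      volume)
    (hφT : ∀ q, φ (T q) = q.1.1)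
    {r : (E × E) × sphere (0 : E) 1 → ℝ} (hrm : Measurable r) (hrpos : ∀ q, 0 < r q)
    (hrT : ∀ q, r (T q) * r q = 1) {C : ℝ≥0∞}
    (hC : ∀ v : E, ∫⁻ w, ∫⁻ ω, ENNReal.ofReal (hardSphereKernel (v, w) ω * globalMaxwellian w *
      r ((v, w), ω)) ∂sphereMeasure ≤ C)
    {f g : E → ℝ} (hf : AEStronglyMeasurable f (stdGaussian E))
    (hg : AEStronglyMeasurable g (stdGaussian E)) :
    ∫⁻ q, ‖collisionDensity q * (f q.1.1 * g (φ q))‖ₑ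
        ∂(((volume : Measure E).prod volume).prod sphereMeasure) ≤
      C * eLpNorm f 2 (stdGaussian E) * eLpNorm g 2 (stdGaussian E) := by
  set Λ : Measure ((E × E) × sphere (0 : E) 1) :=
    ((volume : Measure E).prod volume).prod sphereMeasure with hΛ
  have hfv := aestronglyMeasurable_volume_of_stdGaussian hf
  have hgv := aestronglyMeasurable_volume_of_stdGaussian hg
  -- the data of the weighted Cauchy–Schwarz inequality
  set ρ : (E × E) × sphere (0 : E) 1 → ℝ≥0∞ := fun q => ENNReal.ofReal (collisionDensity q)
  set w : (E × E) × sphere (0 : E) 1 → ℝ≥0∞ := fun q => ENNReal.ofReal (r q)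
  set F : (E × E) × sphere (0 : E) 1 → ℝ≥0∞ := fun q => ‖f q.1.1‖ₑ
  set G : (E × E) × sphere (0 : E) 1 → ℝ≥0∞ := fun q => ‖g (φ q)‖ₑ
  have hρm : Measurable ρ := measurable_collisionDensity.ennreal_ofReal
  have hwm : Measurable w := hrm.ennreal_ofReal
  have hFm : AEMeasurable F Λ :=
    (hfv.comp_quasiMeasurePreserving quasiMeasurePreserving_fst_fst).enorm
  have hGm : AEMeasurable G Λ := (hgv.comp_quasiMeasurePreserving hφ).enorm
  have hwT : ∀ q, w (T q) * w q = 1 := fun q => by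
    simp only [w]
    rw [← ENNReal.ofReal_mul (hrpos _).le, hrT, ENNReal.ofReal_one]
  have hCS := lintegral_mul_mul_le_of_involution hT hρm hwm hFm hGm
    (fun q => by simp only [ρ, hρT]) hwT
  -- the two brackets
  have hrow : ∀ {u : E → ℝ}, AEStronglyMeasurable u (stdGaussian E) →
      ∫⁻ q, ρ q * w q * ‖u q.1.1‖ₑ ^ (2 : ℝ) ∂Λ ≤ C * eLpNorm u 2 (stdGaussian E) ^ (2 : ℝ) := by
    intro u hu
    have huv := aestronglyMeasurable_volume_of_stdGaussian hu
    rw [← lintegral_globalMaxwellian_mul_enorm_sq hu]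
    exact lintegral_collisionDensity_weight_mul_le hrm hC
      (F := fun v => ‖u v‖ₑ ^ (2 : ℝ)) (huv.enorm.pow_const _)
  have h1 : (∫⁻ q, ρ q * w q * F q ^ (2 : ℝ) ∂Λ) ^ (1 / 2 : ℝ) ≤
      C ^ (1 / 2 : ℝ) * eLpNorm f 2 (stdGaussian E) := by
    calc (∫⁻ q, ρ q * w q * F q ^ (2 : ℝ) ∂Λ) ^ (1 / 2 : ℝ)
        ≤ (C * eLpNorm f 2 (stdGaussian E) ^ (2 : ℝ)) ^ (1 / 2 : ℝ) :=
          ENNReal.rpow_le_rpow (hrow hf) (by norm_num)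
      _ = _ := by
          rw [ENNReal.mul_rpow_of_nonneg _ _ (by norm_num : (0 : ℝ) ≤ 1 / 2), ← ENNReal.rpow_mul,
            show (2 : ℝ) * (1 / 2) = 1 by norm_num, ENNReal.rpow_one]
  have h2 : (∫⁻ q, ρ q * w q * G (T q) ^ (2 : ℝ) ∂Λ) ^ (1 / 2 : ℝ) ≤
      C ^ (1 / 2 : ℝ) * eLpNorm g 2 (stdGaussian E) := by
    have hGT : ∀ q, G (T q) = ‖g q.1.1‖ₑ := fun q => by simp only [G, hφT]
    simp_rw [hGT]
    calc (∫⁻ q, ρ q * w q * ‖g q.1.1‖ₑ ^ (2 : ℝ) ∂Λ) ^ (1 / 2 : ℝ)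
        ≤ (C * eLpNorm g 2 (stdGaussian E) ^ (2 : ℝ)) ^ (1 / 2 : ℝ) :=
          ENNReal.rpow_le_rpow (hrow hg) (by norm_num)
      _ = _ := by
          rw [ENNReal.mul_rpow_of_nonneg _ _ (by norm_num : (0 : ℝ) ≤ 1 / 2), ← ENNReal.rpow_mul,
            show (2 : ℝ) * (1 / 2) = 1 by norm_num, ENNReal.rpow_one]
  have hCC : C ^ (1 / 2 : ℝ) * C ^ (1 / 2 : ℝ) = C := by
    rw [← ENNReal.rpow_add_of_nonneg _ _ (by norm_num) (by norm_num),
      show (1 / 2 : ℝ) + 1 / 2 = 1 by norm_num, ENNReal.rpow_one]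
  -- the integrand
  have hpt : ∀ q, ‖collisionDensity q * (f q.1.1 * g (φ q))‖ₑ = ρ q * F q * G q := fun q => by
    simp only [ρ, F, G, enorm_mul, Real.enorm_eq_ofReal (collisionDensity_nonneg q), mul_assoc]
  calc ∫⁻ q, ‖collisionDensity q * (f q.1.1 * g (φ q))‖ₑ ∂Λ = ∫⁻ q, ρ q * F q * G q ∂Λ :=
        lintegral_congr hpt
    _ ≤ _ := hCS
    _ ≤ (C ^ (1 / 2 : ℝ) * eLpNorm f 2 (stdGaussian E)) *
          (C ^ (1 / 2 : ℝ) * eLpNorm g 2 (stdGaussian E)) := mul_le_mul' h1 h2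
    _ = (C ^ (1 / 2 : ℝ) * C ^ (1 / 2 : ℝ)) * eLpNorm f 2 (stdGaussian E) *
          eLpNorm g 2 (stdGaussian E) := by ring
    _ = C * eLpNorm f 2 (stdGaussian E) * eLpNorm g 2 (stdGaussian E) := by rw [hCC]

end Density

/-! ### The kernel forms -/

section Forms

variable {E : Type*} [NormedAddCommGroup E] [InnerProductSpace ℝ E] [FiniteDimensional ℝ E]
  [MeasurableSpace E] [BorelSpace E]

/-- The kernel form `Q_φ(f, g) = ∫ B M M_* f(v) g(φ(v, v_*, ω)) dλ` of the linearised hard-sphere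
operator with transported velocity `φ ∈ {lossVel, gainVelFst, gainVelSnd} = {v_*, v', v_*'}`
(loss term, and the two gain terms of CIP 1994 §7.1 (7.1.6) in the weighted picture `L²(M dv)`);
Bochner integral, junk value `0` when not integrable (it is integrable for `f, g ∈ L²(M dv)`:
`integrable_and_abs_kernelForm_le` with `lintegral_enorm_kernelForm_lossVel_le`,
`lintegral_enorm_kernelForm_gainVelFst_le`, `lintegral_enorm_kernelForm_gainVelSnd_le`).
[cite: CIP1994, §7.1 (7.1.6)] -/
def kernelForm (φ : (E × E) × sphere (0 : E) 1 → E) (f g : E → ℝ) : ℝ :=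
  ∫ q, collisionDensity q * (f q.1.1 * g (φ q)) ∂(((volume : Measure E).prod volume).prod sphereMeasure)

/-- The partner velocity `(v, v_*, ω) ↦ v_*` (loss term). [folklore] -/
def lossVel (q : (E × E) × sphere (0 : E) 1) : E := q.1.2

/-- The first post-collisional velocity `(v, v_*, ω) ↦ v'` (CIP 1994 (3.1.2)). [cite: CIP1994, (3.1.2)] -/
def gainVelFst (q : (E × E) × sphere (0 : E) 1) : E := (collide q.2 q.1).1

/-- The second post-collisional velocity `(v, v_*, ω) ↦ v_*'` (CIP 1994 (3.1.2)). [cite: CIP1994, (3.1.2)] -/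
def gainVelSnd (q : (E × E) × sphere (0 : E) 1) : E := (collide q.2 q.1).2

omit [InnerProductSpace ℝ E] [FiniteDimensional ℝ E] [MeasurableSpace E] [BorelSpace E] in
/-- Unfolding of `lossVel`. [folklore] -/
@[simp] theorem lossVel_apply (q : (E × E) × sphere (0 : E) 1) : lossVel q = q.1.2 := rfl

omit [FiniteDimensional ℝ E] [MeasurableSpace E] [BorelSpace E] in
/-- Unfolding of `gainVelFst`. [folklore] -/
@[simp] theorem gainVelFst_apply (q : (E × E) × sphere (0 : E) 1) :
    gainVelFst q = (collide q.2 q.1).1 := rfl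

omit [FiniteDimensional ℝ E] [MeasurableSpace E] [BorelSpace E] in
/-- Unfolding of `gainVelSnd`. [folklore] -/
@[simp] theorem gainVelSnd_apply (q : (E × E) × sphere (0 : E) 1) :
    gainVelSnd q = (collide q.2 q.1).2 := rfl

/-! #### Algebra of the kernel forms (no integrability needed for homogeneity) -/

/-- `Q_φ(c f, g) = c Q_φ(f, g)`. [folklore] -/
theorem kernelForm_smul_left (φ : (E × E) × sphere (0 : E) 1 → E) (c : ℝ) (f g : E → ℝ) :
    kernelForm φ (fun v => c * f v) g = c * kernelForm φ f g := by
  simp only [kernelForm, ← integral_const_mul]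
  refine integral_congr_ae (Eventually.of_forall fun q => ?_)
  ring

/-- `Q_φ(f, c g) = c Q_φ(f, g)`. [folklore] -/
theorem kernelForm_smul_right (φ : (E × E) × sphere (0 : E) 1 → E) (c : ℝ) (f g : E → ℝ) :
    kernelForm φ f (fun v => c * g v) = c * kernelForm φ f g := by
  simp only [kernelForm, ← integral_const_mul]
  refine integral_congr_ae (Eventually.of_forall fun q => ?_)
  ring

/-- `Q_φ(f₁ + f₂, g) = Q_φ(f₁, g) + Q_φ(f₂, g)` when both integrands are integrable. [folklore] -/
theorem kernelForm_add_left (φ : (E × E) × sphere (0 : E) 1 → E) {f₁ f₂ g : E → ℝ}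
    (h₁ : Integrable (fun q => collisionDensity q * (f₁ q.1.1 * g (φ q)))
      (((volume : Measure E).prod volume).prod sphereMeasure))
    (h₂ : Integrable (fun q => collisionDensity q * (f₂ q.1.1 * g (φ q)))
      (((volume : Measure E).prod volume).prod sphereMeasure)) :
    kernelForm φ (f₁ + f₂) g = kernelForm φ f₁ g + kernelForm φ f₂ g := by
  simp only [kernelForm, ← integral_add h₁ h₂, Pi.add_apply]
  refine integral_congr_ae (Eventually.of_forall fun q => ?_)
  ring

/-- `Q_φ(f, g₁ + g₂) = Q_φ(f, g₁) + Q_φ(f, g₂)` when both integrands are integrable. [folklore] -/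
theorem kernelForm_add_right (φ : (E × E) × sphere (0 : E) 1 → E) {f g₁ g₂ : E → ℝ}
    (h₁ : Integrable (fun q => collisionDensity q * (f q.1.1 * g₁ (φ q)))
      (((volume : Measure E).prod volume).prod sphereMeasure))
    (h₂ : Integrable (fun q => collisionDensity q * (f q.1.1 * g₂ (φ q)))
      (((volume : Measure E).prod volume).prod sphereMeasure)) :
    kernelForm φ f (g₁ + g₂) = kernelForm φ f g₁ + kernelForm φ f g₂ := by
  simp only [kernelForm, ← integral_add h₁ h₂, Pi.add_apply]
  refine integral_congr_ae (Eventually.of_forall fun q => ?_)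
  ring

/-- The kernel forms only see the `M dv`-a.e. classes of their arguments (the transported velocity
being quasi-measure-preserving). [folklore] -/
theorem kernelForm_congr_ae {φ : (E × E) × sphere (0 : E) 1 → E}
    (hφ : Measure.QuasiMeasurePreserving φ (((volume : Measure E).prod volume).prod sphereMeasure)
      volume) {f f' g g' : E → ℝ}
    (hf : f =ᵐ[stdGaussian E] f') (hg : g =ᵐ[stdGaussian E] g') :
    kernelForm φ f g = kernelForm φ f' g' := by
  have hfv : f =ᵐ[(volume : Measure E)] f' :=
    hf.filter_mono volume_absolutelyContinuous_stdGaussian.ae_le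
  have hgv : g =ᵐ[(volume : Measure E)] g' :=
    hg.filter_mono volume_absolutelyContinuous_stdGaussian.ae_le
  have h1 := quasiMeasurePreserving_fst_fst (E := E).ae_eq_comp hfv
  have h2 := hφ.ae_eq_comp hgv
  refine integral_congr_ae ?_
  filter_upwards [h1, h2] with q hq1 hq2
  simp only [Function.comp_apply] at hq1 hq2
  rw [hq1, hq2]

/-- The integrand of a kernel form is a.e.-strongly measurable for `L²(M dv)` (indeed
a.e.-strongly measurable) arguments. [folklore] -/
theorem aestronglyMeasurable_kernelForm_integrand {φ : (E × E) × sphere (0 : E) 1 → E}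
    (hφ : Measure.QuasiMeasurePreserving φ (((volume : Measure E).prod volume).prod sphereMeasure)
      volume) {f g : E → ℝ} (hf : AEStronglyMeasurable f (stdGaussian E))
    (hg : AEStronglyMeasurable g (stdGaussian E)) :
    AEStronglyMeasurable (fun q => collisionDensity q * (f q.1.1 * g (φ q)))
      (((volume : Measure E).prod volume).prod sphereMeasure) :=
  continuous_collisionDensity.aestronglyMeasurable.mul
    (((aestronglyMeasurable_volume_of_stdGaussian hf).comp_quasiMeasurePreserving
      quasiMeasurePreserving_fst_fst).mul
      ((aestronglyMeasurable_volume_of_stdGaussian hg).comp_quasiMeasurePreserving hφ))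

/-- From an `ℝ≥0∞` bound on `∫ |integrand|` to integrability and the real bound
`|Q_φ(f, g)| ≤ C ‖f‖ ‖g‖`. [folklore] -/
theorem integrable_and_abs_kernelForm_le {φ : (E × E) × sphere (0 : E) 1 → E}
    (hφ : Measure.QuasiMeasurePreserving φ (((volume : Measure E).prod volume).prod sphereMeasure)
      volume) {C : ℝ≥0∞} (hC : C ≠ ∞) {f g : E → ℝ} (hf : MemLp f 2 (stdGaussian E))
    (hg : MemLp g 2 (stdGaussian E))
    (hle : ∫⁻ q, ‖collisionDensity q * (f q.1.1 * g (φ q))‖ₑ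
        ∂(((volume : Measure E).prod volume).prod sphereMeasure) ≤
      C * eLpNorm f 2 (stdGaussian E) * eLpNorm g 2 (stdGaussian E)) :
    Integrable (fun q => collisionDensity q * (f q.1.1 * g (φ q)))
        (((volume : Measure E).prod volume).prod sphereMeasure) ∧
      |kernelForm φ f g| ≤
        C.toReal * (eLpNorm f 2 (stdGaussian E)).toReal * (eLpNorm g 2 (stdGaussian E)).toReal := by
  have hfin : C * eLpNorm f 2 (stdGaussian E) * eLpNorm g 2 (stdGaussian E) ≠ ∞ :=
    ENNReal.mul_ne_top (ENNReal.mul_ne_top hC hf.eLpNorm_ne_top) hg.eLpNorm_ne_top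
  refine ⟨⟨aestronglyMeasurable_kernelForm_integrand hφ hf.1 hg.1,
    hasFiniteIntegral_iff_enorm.2 (lt_of_le_of_lt hle hfin.lt_top)⟩, ?_⟩
  have h := (enorm_integral_le_lintegral_enorm _).trans hle
  rw [← ENNReal.toReal_mul, ← ENNReal.toReal_mul, ← Real.norm_eq_abs,
    ← ENNReal.ofReal_le_iff_le_toReal hfin, ofReal_norm]
  exact h

/-! #### The row constants -/

variable (E) in
/-- The row constant of the loss weight (`exists_lossWeight_rowBound`). [folklore] -/
def lossRowConst : ℝ≥0∞ := (exists_lossWeight_rowBound (E := E)).choose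

variable (E) in
/-- The row constant of the gain weight of `g(v')` (`exists_gainWeightFst_rowBound`). [folklore] -/
def gainFstRowConst : ℝ≥0∞ := (exists_gainWeightFst_rowBound (E := E)).choose

/-- The row constant of the gain weight of `g(v_*')`, in dimension `d ≥ 2`
(`exists_gainWeightSnd_rowBound`). [folklore] -/
def gainSndRowConst (hE : 2 ≤ finrank ℝ E) : ℝ≥0∞ := (exists_gainWeightSnd_rowBound hE).choose

/-- `lossRowConst E < ∞`. [folklore] -/
theorem lossRowConst_ne_top : lossRowConst E ≠ ∞ := (exists_lossWeight_rowBound (E := E)).choose_spec.1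

/-- `gainFstRowConst E < ∞`. [folklore] -/
theorem gainFstRowConst_ne_top : gainFstRowConst E ≠ ∞ :=
  (exists_gainWeightFst_rowBound (E := E)).choose_spec.1

/-- `gainSndRowConst hE < ∞`. [folklore] -/
theorem gainSndRowConst_ne_top (hE : 2 ≤ finrank ℝ E) : gainSndRowConst hE ≠ ∞ :=
  (exists_gainWeightSnd_rowBound hE).choose_spec.1

/-- The defining row bound of `lossRowConst`. [folklore] -/
theorem rowBound_lossRowConst (v : E) :
    ∫⁻ w, ∫⁻ ω, ENNReal.ofReal (hardSphereKernel (v, w) ω * globalMaxwellian w *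
      ((1 + ‖w‖) / (1 + ‖v‖)) ^ 2) ∂sphereMeasure ≤ lossRowConst E :=
  (exists_lossWeight_rowBound (E := E)).choose_spec.2 v

/-- The defining row bound of `gainFstRowConst`. [folklore] -/
theorem rowBound_gainFstRowConst (v : E) :
    ∫⁻ w, ∫⁻ ω, ENNReal.ofReal (hardSphereKernel (v, w) ω * globalMaxwellian w *
      exp ((‖w‖ ^ 2 - ‖(collide ω (v, w)).2‖ ^ 2) / 4)) ∂sphereMeasure ≤ gainFstRowConst E :=
  (exists_gainWeightFst_rowBound (E := E)).choose_spec.2 v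

/-- The defining row bound of `gainSndRowConst`. [folklore] -/
theorem rowBound_gainSndRowConst (hE : 2 ≤ finrank ℝ E) (v : E) :
    ∫⁻ w, ∫⁻ ω, ENNReal.ofReal (hardSphereKernel (v, w) ω * globalMaxwellian w *
      exp ((‖w‖ ^ 2 - ‖(collide ω (v, w)).1‖ ^ 2) / 4)) ∂sphereMeasure ≤ gainSndRowConst hE :=
  (exists_gainWeightSnd_rowBound hE).choose_spec.2 v

/-! #### The three bounds -/

/-- `(v, v_*, ω) ↦ v_*` is quasi-measure-preserving. [folklore] -/
theorem quasiMeasurePreserving_lossVel :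
    Measure.QuasiMeasurePreserving (lossVel (E := E))
      (((volume : Measure E).prod volume).prod sphereMeasure) volume :=
  quasiMeasurePreserving_fst_snd

/-- `(v, v_*, ω) ↦ v'` is quasi-measure-preserving. [folklore] -/
theorem quasiMeasurePreserving_gainVelFst :
    Measure.QuasiMeasurePreserving (gainVelFst (E := E))
      (((volume : Measure E).prod volume).prod sphereMeasure) volume :=
  quasiMeasurePreserving_collide_fst

/-- `(v, v_*, ω) ↦ v_*'` is quasi-measure-preserving. [folklore] -/
theorem quasiMeasurePreserving_gainVelSnd :
    Measure.QuasiMeasurePreserving (gainVelSnd (E := E))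
      (((volume : Measure E).prod volume).prod sphereMeasure) volume :=
  quasiMeasurePreserving_collide_snd

/-- **The loss form is bounded on `L²(M dv)`**: `∫ B M M_* |f(v)| |g(v_*)| dλ ≤ C₁ ‖f‖ ‖g‖`
(weight `(1 + |v_*|)²/(1 + |v|)²`, involution `T₂`). [folklore] -/
theorem lintegral_enorm_kernelForm_lossVel_le {f g : E → ℝ}
    (hf : AEStronglyMeasurable f (stdGaussian E)) (hg : AEStronglyMeasurable g (stdGaussian E)) :
    ∫⁻ q, ‖collisionDensity q * (f q.1.1 * g (lossVel q))‖ₑ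
        ∂(((volume : Measure E).prod volume).prod sphereMeasure) ≤
      lossRowConst E * eLpNorm f 2 (stdGaussian E) * eLpNorm g 2 (stdGaussian E) := by
  refine lintegral_collisionDensity_mul_mul_le (T := fun q => (q.1.swap, -q.2))
    measurePreserving_swap_negDir collisionDensity_swap_negDir quasiMeasurePreserving_lossVel
    (fun q => rfl) (r := fun q => ((1 + ‖q.1.2‖) / (1 + ‖q.1.1‖)) ^ 2) (by fun_prop)
    (fun q => by positivity) (fun q => ?_) rowBound_lossRowConst hf hg
  simp only [Prod.fst_swap, Prod.snd_swap]
  rw [← mul_pow, div_mul_div_comm, mul_comm (1 + ‖q.1.1‖), div_self (by positivity), one_pow]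

/-- **The first gain form is bounded on `L²(M dv)`**: `∫ B M M_* |f(v)| |g(v')| dλ ≤ C₂ ‖f‖ ‖g‖`
(weight `e^{(|v_*|² - |v_*'|²)/4}`, involution `T₂T₁ = (v', v_*', -ω)`). This is Grad's
`K₂ ∈ B(L²)` for the `v'`-term (CIP 1994 §7.2 Thm 7.2.4), in any dimension. [cite: CIP1994, §7.2 Thm 7.2.4] -/
theorem lintegral_enorm_kernelForm_gainVelFst_le {f g : E → ℝ}
    (hf : AEStronglyMeasurable f (stdGaussian E)) (hg : AEStronglyMeasurable g (stdGaussian E)) :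
    ∫⁻ q, ‖collisionDensity q * (f q.1.1 * g (gainVelFst q))‖ₑ
        ∂(((volume : Measure E).prod volume).prod sphereMeasure) ≤
      gainFstRowConst E * eLpNorm f 2 (stdGaussian E) * eLpNorm g 2 (stdGaussian E) := by
  refine lintegral_collisionDensity_mul_mul_le (T := fun q => (collide q.2 q.1, -q.2))
    measurePreserving_collide_negDir collisionDensity_collide_negDir
    quasiMeasurePreserving_gainVelFst (fun q => ?_)
    (r := fun q => exp ((‖q.1.2‖ ^ 2 - ‖(collide q.2 q.1).2‖ ^ 2) / 4)) (by fun_prop)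
    (fun q => exp_pos _) (fun q => ?_) rowBound_gainFstRowConst hf hg
  · simp only [gainVelFst_apply, collide_neg_dir, collide_collide]
  · simp only [collide_neg_dir, collide_collide]
    rw [← Real.exp_add]
    convert Real.exp_zero using 2
    ring

/-- **The second gain form is bounded on `L²(M dv)`** in dimension `d ≥ 2`:
`∫ B M M_* |f(v)| |g(v_*')| dλ ≤ C₃ ‖f‖ ‖g‖` (weight `e^{(|v_*|² - |v'|²)/4}`, involution
`T₁ = (v_*', v', ω)`, cap lemma). This is Grad's `K₂ ∈ B(L²)` for the `v_*'`-term
(CIP 1994 §7.2 Thm 7.2.4), in any dimension `≥ 2`. [cite: CIP1994, §7.2 Thm 7.2.4] -/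
theorem lintegral_enorm_kernelForm_gainVelSnd_le (hE : 2 ≤ finrank ℝ E) {f g : E → ℝ}
    (hf : AEStronglyMeasurable f (stdGaussian E)) (hg : AEStronglyMeasurable g (stdGaussian E)) :
    ∫⁻ q, ‖collisionDensity q * (f q.1.1 * g (gainVelSnd q))‖ₑ
        ∂(((volume : Measure E).prod volume).prod sphereMeasure) ≤
      gainSndRowConst hE * eLpNorm f 2 (stdGaussian E) * eLpNorm g 2 (stdGaussian E) := by
  refine lintegral_collisionDensity_mul_mul_le (T := fun q => ((collide q.2 q.1).swap, q.2))
    measurePreserving_collideSwap_prod collisionDensity_collideSwap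
    quasiMeasurePreserving_gainVelSnd (fun q => ?_)
    (r := fun q => exp ((‖q.1.2‖ ^ 2 - ‖(collide q.2 q.1).1‖ ^ 2) / 4)) (by fun_prop)
    (fun q => exp_pos _) (fun q => ?_) (rowBound_gainSndRowConst hE) hf hg
  · simp only [gainVelSnd_apply, collide_collideSwap, Prod.snd_swap]
  · simp only [collide_collideSwap, Prod.snd_swap, Prod.fst_swap]
    rw [← Real.exp_add]
    convert Real.exp_zero using 2
    ring

/-! #### Symmetry -/

/-- Change of variables `(v, v_*, ω) ↦ (v', v_*', -ω)` in integrals over `E × E × S^{d-1}`.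
[folklore] -/
theorem integral_comp_collide_negDir {F : Type*} [NormedAddCommGroup F] [NormedSpace ℝ F]
    (K : (E × E) × sphere (0 : E) 1 → F) :
    ∫ q, K (collide q.2 q.1, -q.2) ∂(((volume : Measure E).prod volume).prod sphereMeasure) =
      ∫ q, K q ∂(((volume : Measure E).prod volume).prod sphereMeasure) := by
  have h1 := integral_comp_collideSwap_prod (E := E) (fun q => K (q.1.swap, -q.2))
  simp only [Prod.swap_swap] at h1
  rw [h1, integral_comp_swap_negDir]

/-- The loss form is symmetric: `Q₁(f, g) = Q₁(g, f)` (exchange `v ↔ v_*`). [folklore] -/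
theorem kernelForm_lossVel_comm (f g : E → ℝ) :
    kernelForm lossVel f g = kernelForm lossVel g f := by
  simp only [kernelForm, lossVel_apply]
  rw [← integral_comp_swap_negDir]
  refine integral_congr_ae (Eventually.of_forall fun q => ?_)
  simp only [collisionDensity_swap_negDir, Prod.fst_swap, Prod.snd_swap]
  ring

/-- The first gain form is symmetric: `Q₂'(f, g) = Q₂'(g, f)` (change of variables
`(v, v_*, ω) ↦ (v', v_*', -ω)`; CIP 1994 §7.2: "`K` is an integral operator with a real
measurable symmetric kernel"). [cite: CIP1994, §7.2 Thm 7.2.1] -/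
theorem kernelForm_gainVelFst_comm (f g : E → ℝ) :
    kernelForm gainVelFst f g = kernelForm gainVelFst g f := by
  simp only [kernelForm, gainVelFst_apply]
  rw [← integral_comp_collide_negDir]
  refine integral_congr_ae (Eventually.of_forall fun q => ?_)
  simp only [collisionDensity_collide_negDir, collide_neg_dir, collide_collide]
  ring

/-- The second gain form is symmetric: `Q₂''(f, g) = Q₂''(g, f)` (change of variables
`(v, v_*, ω) ↦ (v_*', v', ω)`). [cite: CIP1994, §7.2 Thm 7.2.1] -/
theorem kernelForm_gainVelSnd_comm (f g : E → ℝ) :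
    kernelForm gainVelSnd f g = kernelForm gainVelSnd g f := by
  simp only [kernelForm, gainVelSnd_apply]
  rw [← integral_comp_collideSwap_prod]
  refine integral_congr_ae (Eventually.of_forall fun q => ?_)
  simp only [collisionDensity_collideSwap, collide_collideSwap, Prod.fst_swap, Prod.snd_swap]
  ring

end Forms

end

end Literature.Analysis.UnboundedOperators
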